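import Literature.MathematicalPhysics.QuantumFieldTheory.Balaban1983to89.Beta.EntrywiseVolumeLimit
import Literature.MathematicalPhysics.QuantumFieldTheory.Balaban1983to89.B12Decay510Window
import Literature.MathematicalPhysics.QuantumFieldTheory.Balaban1983to89.QGQInverse

/-!
# The `ℤ^d` Green's function of a COERCIVE finite-range kernel: existence, two-sidedness, exponential decay and
# block-periodicity WITHOUT ANY SMALLNESS — finite Combes–Thomas on boxes + a compactness limit
# (`Beta.RemainderKernelGreenCoercive`)

statement-level skeleton of published theorems with citation tags; proofs where landed; nothing here is a claim
about the Yang–Mills mass gap.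

HONEST FRAMING (cell rule).  Bookkeeping for the k-uniform remainder chain of row (D4) (`RemainderConst` ⇐ ONE
`ChainTFac190` instance, `Beta.RemainderDecay190`); discharges NOTHING of `BetaPertH`; NOT B12 Thm 2, NOT the continuum
limit, NOT Clay.  Unit `b2b-balaban-beta-an4` gen 98 (BINDER row D4 OWNER; cell pub-balaban).  Imports
`Beta.EntrywiseVolumeLimit` (gen 9: `Kernel₂`, `Decay₂`, `IsPeriodic₂`, `RowBound`, `HasRange`, `compKer`, `kdelta`,
`IsPeriodic₂.of_inverse`, `Decay₂.rowBound`), `B12Decay510Window` (`l1_sub_triangle`, `l1_sub_comm`) and `QGQInverse`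
(reader r1: `Coercive`, `isUnit_of_coercive`, **`inverse_decay`** = the finite Combes–Thomas argument) ONLY, all BY NAME;
nothing edited, no engine re-proved.  [folklore] — a composition, no new idea.

WHY.  Every kernel-side letter of the row-(D4) model road (`RemainderDecay190SupNormPieces` … `RemainderDecay190PrimitiveEnd`)
and the LABELLED INPUT `K^∞` of `EntrywiseVolumeLimit` §4 have the shape «a `ℤ^d` kernel `S` with `T ∘ S = δ`,
`Decay₂ S C δ`, jointly block-periodic».  Gen 97 produced such `S` for SMALL perturbations of the identity (Neumann series,
`RemainderKernelNeumannExistence.exists_green_of_perturbation`; the nearest-neighbour resolvent only at LARGE mass,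
`RemainderKernelFiniteRange.exists_green_nearestNeighbour`).  The operators whose Green's functions Bałaban's pieces are
(`−Δ + aQ*Q`, `−Δ + m²`, their covariant versions) are NOT small perturbations of the identity; what they are is COERCIVE
(strictly positive as quadratic forms) and LOCAL.  THIS FILE proves the smallness-free statement for that whole class:

* §1  boxes `[-N,N]^d` exhaust `ℤ^d` (`eventually_mem_cube`); for a finite-range `T` the compositions `T ∘ K`, `K ∘ T` are
  FINITE sums over sup-balls (`compKer_eq_sum_left/right`).
* §2  ONE FINITE VOLUME: the principal submatrix `T_s = (T(i,j))_{i,j∈s}` of a `γ`-coercive kernel is invertible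
  (`restrict_mul_inv`, `restrict_inv_mul`), and r1's finite Combes–Thomas theorem `QGQInverse.inverse_decay` with the `ℓ¹`
  lattice distance gives **`abs_restrict_inv_le`**: `|T_s⁻¹(i,j)| ≤ (γ − ρ)⁻¹ e^{−κ|i−j|₁}` whenever the
  `(e^{κ|x−y|₁} − 1)`-weighted absolute row∕column sums of `T` are `≤ ρ < γ` — constants FREE of `s`; extended by zero,
  `T ∘ G_s = δ = G_s ∘ T` at pairs of sites of `s` (`compKer_extend_inv`, `compKer_extend_inv'`).
* §3  **`exists_green_of_coercive_exhaustion`** (any exhausting sequence of finsets on which the principal submatrices are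
  `γ`-coercive) ∕ **`exists_green_of_coercive`** (cubes): along the boxes the extended inverses lie in the compact set
  `Π_{x,y} [−B(x,y), B(x,y)]`, `B(x,y) = (γ − ρ)⁻¹e^{−κ|x−y|₁}` (Tychonoff, `isCompact_pi_infinite`); a subsequence converges
  entrywise (`IsCompact.tendsto_subseq` — `ℤ^d × ℤ^d` is countable, so the product is first countable); the identities are
  finite sums, eventually exact at every fixed pair of sites, and pass to the limit: `∃ S, T ∘ S = δ ∧ S ∘ T = δ ∧
  Decay₂ S (γ − ρ)⁻¹ κ`.  **`exists_green_of_coercive_periodic`**: with `κ > 0` and a row bound on `T`, `S` is jointly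
  `n`-periodic for every period `n` of `T` (gen 9's uniqueness-of-two-sided-inverses lemma `IsPeriodic₂.of_inverse`).
* §4  the hypotheses from ELEMENTARY data: coercivity of the principal submatrices from the form on finitely supported
  functions (`coercive_restrict_of_form`); the weighted row ∕ column sums and the row bound from `HasRange T R` + an entry
  bound `a` (`weightedRowSum_le_of_hasRange`: `≤ a(2R+1)^d(e^{κdR} − 1) → 0` as `κ → 0`; `rowBound_of_hasRange`); and the
  HEADLINE **`exists_green_of_coercive_hasRange`**: finite range + bounded entries + uniformly `γ`-coercive principal
  submatrices ⟹ `∃ κ > 0, ∃ S, T ∘ S = δ = S ∘ T ∧ Decay₂ S (2∕γ) κ ∧ (∀ n, IsPeriodic₂ n T → IsPeriodic₂ n S)`.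
The companion `Beta.RemainderKernelGreenLattice` (staged behind this file) runs the instance `T = −Δ + m²` on `ℤ^d`:
principal submatrices `m²`-coercive (at most `2d` neighbours, Schur), hence an exponentially decaying two-sided Green's
function for EVERY `m ≠ 0` — the lattice Yukawa potential, with no large-mass condition.
WHAT IS *NOT* DONE: nothing here identifies `T` with any operator of Bałaban's — `−Δ + aQ*Q` and its covariant ∕
multi-level versions need THEIR coercivity on principal submatrices (blockwise Poincaré; an2's `TorusG0Decay.coercive_torus`
is the torus-side model) before this file applies; the averaging-constrained propagators `G̃` of [15] are inverses on
SUBSPACES, not covered; [5] Thm 3.12 ∕ [15] (46), (130) remain INPUTS of the model road; row D4 class UNCHANGED (instance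
0∕1; critical-path width 0 = NODE O; D4 DISCHARGE NO DATE).  No `def`, no named fact, no `sorry`, standard axioms.
HONEST DEPENDENCY: continuum YM on T⁴ ⇐ BetaPertH ∧ nine spine estimates (0/9 proved); BetaPertH ⇐ (D1) ∧ (D4) ∧
CAP+tail; G-an2-4 gates asym, D1 and NE2/3/4.

Sources: J.-M. Combes, L. Thomas, Commun. Math. Phys. **34** (1973) 251–270 [CombesThomas1973], §II (the weighted-
conjugation argument; here in r1's finite form `QGQInverse.inverse_decay`); [5] = T. Bałaban, Commun. Math. Phys. **95**
(1984) 17–40 [Balaban1984PropagatorsI], Prop. 1.2 (1.110) p. 35 and p. 36 («relating G on the torus to G on the whole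
lattice … in the usual way») — context for WHICH Green's functions the row consumes; [3] = Commun. Math. Phys. **96** (1984)
223–250 [Balaban1984PropagatorsII], Lemma 2.1 p. 234 (exponential bookkeeping on `ℤ^d`); G. Slade, Commun. Math. Phys.
**358** (2018) [Slade2017], Lemma 2.2.2 (block-periodic inverses; proved in `EntrywiseVolumeLimit`).
-/

namespace Literature.MathematicalPhysics.QuantumFieldTheory.Balaban1983to89.Beta.RemainderKernelGreenCoercive

open Literature.MathematicalPhysics.QuantumFieldTheory.Balaban1983to89
open Literature.MathematicalPhysics.QuantumFieldTheory.Balaban1983to89.B12Sec2to5 (l1 l1_nonneg abs_coord_le_l1)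
open Literature.MathematicalPhysics.QuantumFieldTheory.Balaban1983to89.B12Decay510Window (l1_sub_triangle l1_sub_comm)
open Literature.MathematicalPhysics.QuantumFieldTheory.Balaban1983to89.Beta
  (Kernel₂ Decay₂ IsPeriodic₂ RowBound HasRange compKer kdelta)
open Literature.MathematicalPhysics.QuantumFieldTheory.Balaban1983to89.QGQInverse (Coercive isUnit_of_coercive
  inverse_decay)
open _root_.Filter
open scoped _root_.Topology

variable {d : ℕ}

/-! ## §1. Boxes exhaust `ℤ^d`; finite range makes `compKer` a finite sum -/

/-- Every site lies in the cube `[-N, N]^d` for all large `N`. [cite: Balaban1984PropagatorsII, Lemma 2.1 p.234] [folklore] -/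
theorem eventually_mem_cube (x : Fin d → ℤ) :
    ∀ᶠ N : ℕ in atTop, x ∈ Fintype.piFinset fun _ : Fin d => Finset.Icc (-(N : ℤ)) N := by
  refine eventually_atTop.2 ⟨Finset.univ.sup fun i => (x i).natAbs, fun N hN => ?_⟩
  refine Fintype.mem_piFinset.2 fun i => Finset.mem_Icc.2 ?_
  have h1 : (x i).natAbs ≤ N := le_trans (Finset.le_sup (f := fun i => (x i).natAbs) (Finset.mem_univ i)) hN
  have h2 : |x i| ≤ (N : ℤ) := by
    rw [← Int.natCast_natAbs]; exact_mod_cast h1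
  exact abs_le.1 h2

/-- Outside the sup-ball of radius `R` around `x` a kernel of range `R` vanishes: `T x y = 0`.
[cite: Balaban1984PropagatorsII, Lemma 2.1 p.234] [folklore] -/
theorem eq_zero_of_not_mem_nbhd {T : Kernel₂ d} {R : ℕ} (hT : HasRange T R) {x y : Fin d → ℤ}
    (hy : y ∉ Fintype.piFinset fun i : Fin d => Finset.Icc (x i - R) (x i + R)) : T x y = 0 := by
  apply hT x y
  by_contra h
  push Not at h
  apply hy
  refine Fintype.mem_piFinset.2 fun i => Finset.mem_Icc.2 ?_
  have := abs_le.1 (h i)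
  constructor <;> linarith [this.1, this.2]

/-- Symmetric form: `T y x = 0` for `y` outside the sup-ball of radius `R` around `x`.
[cite: Balaban1984PropagatorsII, Lemma 2.1 p.234] [folklore] -/
theorem eq_zero_of_not_mem_nbhd' {T : Kernel₂ d} {R : ℕ} (hT : HasRange T R) {x y : Fin d → ℤ}
    (hy : y ∉ Fintype.piFinset fun i : Fin d => Finset.Icc (x i - R) (x i + R)) : T y x = 0 := by
  apply hT y x
  by_contra h
  push Not at h
  apply hy
  refine Fintype.mem_piFinset.2 fun i => Finset.mem_Icc.2 ?_
  have := abs_le.1 (h i)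
  constructor <;> linarith [this.1, this.2]

/-- For a finite-range `T`, `(T ∘ K)(x, z)` is the FINITE sum over the sup-ball around `x`.
[cite: Balaban1984PropagatorsII, Lemma 2.1 p.234] [folklore] -/
theorem compKer_eq_sum_left {T : Kernel₂ d} {R : ℕ} (hT : HasRange T R) (K : Kernel₂ d) (x z : Fin d → ℤ) :
    compKer T K x z = ∑ y ∈ Fintype.piFinset (fun i : Fin d => Finset.Icc (x i - R) (x i + R)), T x y * K y z := by
  unfold compKer
  exact tsum_eq_sum fun y hy => by rw [eq_zero_of_not_mem_nbhd hT hy, zero_mul]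

/-- For a finite-range `T`, `(K ∘ T)(x, z)` is the FINITE sum over the sup-ball around `z`.
[cite: Balaban1984PropagatorsII, Lemma 2.1 p.234] [folklore] -/
theorem compKer_eq_sum_right {T : Kernel₂ d} {R : ℕ} (hT : HasRange T R) (K : Kernel₂ d) (x z : Fin d → ℤ) :
    compKer K T x z = ∑ y ∈ Fintype.piFinset (fun i : Fin d => Finset.Icc (z i - R) (z i + R)), K x y * T y z := by
  unfold compKer
  exact tsum_eq_sum fun y hy => by rw [eq_zero_of_not_mem_nbhd' hT hy, mul_zero]

/-! ## §2. One finite volume: the principal submatrix on a finset `s`, its inverse, the Combes–Thomas entry bound -/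

section Box

variable {T : Kernel₂ d} {s : Finset (Fin d → ℤ)} {γ κ ρ : ℝ}

/-- The principal submatrix of a coercive kernel is invertible: `T_s · T_s⁻¹ = 1`. [cite: CombesThomas1973, §II] [folklore] -/
theorem restrict_mul_inv (hγ : 0 < γ) (hco : Coercive (Matrix.of fun i j : ↥s => T i j) γ) :
    (Matrix.of fun i j : ↥s => T i j) * (Matrix.of fun i j : ↥s => T i j)⁻¹ = 1 :=
  Matrix.mul_nonsing_inv _ ((Matrix.isUnit_iff_isUnit_det _).mp (isUnit_of_coercive hγ hco))

/-- … and `T_s⁻¹ · T_s = 1`. [cite: CombesThomas1973, §II] [folklore] -/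
theorem restrict_inv_mul (hγ : 0 < γ) (hco : Coercive (Matrix.of fun i j : ↥s => T i j) γ) :
    (Matrix.of fun i j : ↥s => T i j)⁻¹ * (Matrix.of fun i j : ↥s => T i j) = 1 :=
  Matrix.nonsing_inv_mul _ ((Matrix.isUnit_iff_isUnit_det _).mp (isUnit_of_coercive hγ hco))

/-- **FINITE COMBES–THOMAS ON THE BOX** (`QGQInverse.inverse_decay` with the `ℓ¹` lattice distance): coercivity `γ` of
the principal submatrix and `(e^{κ|x−y|₁} − 1)`-weighted absolute row ∕ column sums `≤ ρ < γ` give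
`|T_s⁻¹(i, j)| ≤ (γ − ρ)⁻¹ e^{−κ|i − j|₁}`, with constants free of `s`. [cite: CombesThomas1973, §II] [folklore] -/
theorem abs_restrict_inv_le (hγρ : ρ < γ) (hκ : 0 ≤ κ) (hco : Coercive (Matrix.of fun i j : ↥s => T i j) γ)
    (hrow : ∀ (x : Fin d → ℤ) (t : Finset (Fin d → ℤ)), ∑ y ∈ t, |T x y| * (Real.exp (κ * l1 (x - y)) - 1) ≤ ρ)
    (hcol : ∀ (y : Fin d → ℤ) (t : Finset (Fin d → ℤ)), ∑ x ∈ t, |T x y| * (Real.exp (κ * l1 (x - y)) - 1) ≤ ρ)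
    (i j : ↥s) :
    |(Matrix.of fun i j : ↥s => T i j)⁻¹ i j| ≤ (γ - ρ)⁻¹ * Real.exp (-(κ * l1 ((i : Fin d → ℤ) - (j : Fin d → ℤ)))) := by
  refine inverse_decay (Matrix.of fun i j : ↥s => T i j) (fun i j : ↥s => l1 ((i : Fin d → ℤ) - (j : Fin d → ℤ))) hγρ hκ hco
    (fun i j => l1_sub_comm _ _) (fun i => by simp [B12Sec2to5.l1]) (fun i j k => l1_sub_triangle _ _ _)
    (fun i => ?_) (fun j => ?_) i j
  · have h := hrow i s
    rw [← Finset.sum_coe_sort s (fun y => |T i y| * (Real.exp (κ * l1 ((i : Fin d → ℤ) - y)) - 1))] at h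
    simpa only [Matrix.of_apply] using h
  · have h := hcol j s
    rw [← Finset.sum_coe_sort s (fun x => |T x j| * (Real.exp (κ * l1 (x - (j : Fin d → ℤ))) - 1))] at h
    simpa only [Matrix.of_apply] using h

/-- The inverse EXTENDED BY ZERO to a `ℤ^d` kernel obeys the same bound everywhere.
[cite: CombesThomas1973, §II] [folklore] -/
theorem abs_extend_inv_le (hγρ : ρ < γ) (hκ : 0 ≤ κ) (hco : Coercive (Matrix.of fun i j : ↥s => T i j) γ)
    (hrow : ∀ (x : Fin d → ℤ) (t : Finset (Fin d → ℤ)), ∑ y ∈ t, |T x y| * (Real.exp (κ * l1 (x - y)) - 1) ≤ ρ)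
    (hcol : ∀ (y : Fin d → ℤ) (t : Finset (Fin d → ℤ)), ∑ x ∈ t, |T x y| * (Real.exp (κ * l1 (x - y)) - 1) ≤ ρ)
    (x y : Fin d → ℤ) :
    |(if h : x ∈ s ∧ y ∈ s then (Matrix.of fun i j : ↥s => T i j)⁻¹ ⟨x, h.1⟩ ⟨y, h.2⟩ else (0 : ℝ))|
      ≤ (γ - ρ)⁻¹ * Real.exp (-(κ * l1 (x - y))) := by
  split_ifs with h
  · exact abs_restrict_inv_le hγρ hκ hco hrow hcol ⟨x, h.1⟩ ⟨y, h.2⟩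
  · rw [abs_zero]
    exact mul_nonneg (inv_nonneg.2 (by linarith)) (Real.exp_pos _).le

/-- On the box, the extended inverse is a RIGHT inverse: `Σ'_y T(x,y) G_s(y,z) = δ(x,z)` for `x, z ∈ s`.
[cite: CombesThomas1973, §II] [folklore] -/
theorem compKer_extend_inv (hγ : 0 < γ) (hco : Coercive (Matrix.of fun i j : ↥s => T i j) γ)
    {x z : Fin d → ℤ} (hx : x ∈ s) (hz : z ∈ s) :
    compKer T (fun a b => if h : a ∈ s ∧ b ∈ s then (Matrix.of fun i j : ↥s => T i j)⁻¹ ⟨a, h.1⟩ ⟨b, h.2⟩ else 0)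
      x z = kdelta x z := by
  have hmul := restrict_mul_inv hγ hco
  have hentry := congrFun (congrFun hmul ⟨x, hx⟩) ⟨z, hz⟩
  rw [Matrix.mul_apply, Matrix.one_apply] at hentry
  unfold compKer
  beta_reduce
  rw [tsum_eq_sum (s := s) (fun y hy => by rw [dif_neg (fun h => hy h.1), mul_zero])]
  rw [← Finset.sum_coe_sort s (fun y => T x y *
    (if h : y ∈ s ∧ z ∈ s then (Matrix.of fun i j : ↥s => T i j)⁻¹ ⟨y, h.1⟩ ⟨z, h.2⟩ else 0))]
  have e : ∀ i : ↥s, T x (i : Fin d → ℤ) * (if h : (i : Fin d → ℤ) ∈ s ∧ z ∈ s then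
      (Matrix.of fun i j : ↥s => T i j)⁻¹ ⟨(i : Fin d → ℤ), h.1⟩ ⟨z, h.2⟩ else 0)
      = (Matrix.of fun i j : ↥s => T i j) ⟨x, hx⟩ i * (Matrix.of fun i j : ↥s => T i j)⁻¹ i ⟨z, hz⟩ := by
    intro i
    have hi : (i : Fin d → ℤ) ∈ s := i.2
    simp only [hi, hz, and_self, ↓reduceDIte, Matrix.of_apply, Subtype.coe_eta]
  rw [Finset.sum_congr rfl (fun i _ => e i), hentry]
  simp only [kdelta, Subtype.mk.injEq]

/-- On the box, the extended inverse is a LEFT inverse: `Σ'_y G_s(x,y) T(y,z) = δ(x,z)` for `x, z ∈ s`.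
[cite: CombesThomas1973, §II] [folklore] -/
theorem compKer_extend_inv' (hγ : 0 < γ) (hco : Coercive (Matrix.of fun i j : ↥s => T i j) γ)
    {x z : Fin d → ℤ} (hx : x ∈ s) (hz : z ∈ s) :
    compKer (fun a b => if h : a ∈ s ∧ b ∈ s then (Matrix.of fun i j : ↥s => T i j)⁻¹ ⟨a, h.1⟩ ⟨b, h.2⟩ else 0) T
      x z = kdelta x z := by
  have hmul := restrict_inv_mul hγ hco
  have hentry := congrFun (congrFun hmul ⟨x, hx⟩) ⟨z, hz⟩
  rw [Matrix.mul_apply, Matrix.one_apply] at hentry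
  unfold compKer
  beta_reduce
  rw [tsum_eq_sum (s := s) (fun y hy => by rw [dif_neg (fun h => hy h.2), zero_mul])]
  rw [← Finset.sum_coe_sort s (fun y =>
    (if h : x ∈ s ∧ y ∈ s then (Matrix.of fun i j : ↥s => T i j)⁻¹ ⟨x, h.1⟩ ⟨y, h.2⟩ else 0) * T y z)]
  have e : ∀ i : ↥s, (if h : x ∈ s ∧ (i : Fin d → ℤ) ∈ s then
      (Matrix.of fun i j : ↥s => T i j)⁻¹ ⟨x, h.1⟩ ⟨(i : Fin d → ℤ), h.2⟩ else 0) * T (i : Fin d → ℤ) z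
      = (Matrix.of fun i j : ↥s => T i j)⁻¹ ⟨x, hx⟩ i * (Matrix.of fun i j : ↥s => T i j) i ⟨z, hz⟩ := by
    intro i
    have hi : (i : Fin d → ℤ) ∈ s := i.2
    simp only [hx, hi, and_self, ↓reduceDIte, Matrix.of_apply, Subtype.coe_eta]
  rw [Finset.sum_congr rfl (fun i _ => e i), hentry]
  simp only [kdelta, Subtype.mk.injEq]

end Box

/-! ## §3. The infinite-volume Green's function: existence, decay, two-sidedness (compactness along the boxes) -/

/-- **THE `ℤ^d` GREEN'S FUNCTION OF A COERCIVE FINITE-RANGE KERNEL ALONG AN EXHAUSTION — NO SMALLNESS.**  Let `T`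
have finite range `R`; let `bx N` be finsets exhausting `ℤ^d` (every site eventually inside) on which the principal
submatrices `(T(i,j))_{i,j ∈ bx N}` are `γ`-coercive (`γ > ρ`); and let the `(e^{κ|x−y|₁} − 1)`-weighted absolute row and
column sums of `T` be `≤ ρ` (`κ ≥ 0`).  Then there is a kernel `S` on `ℤ^d` with `T ∘ S = δ = S ∘ T` and
`|S(x,y)| ≤ (γ − ρ)⁻¹ e^{−κ|x−y|₁}`.  Proof: the inverses of the principal submatrices obey this bound uniformly in `N`
(§2); a subsequence converges entrywise (Tychonoff); the identities `T_N G_N = 1 = G_N T_N` are finite sums by finite range,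
eventually exact at each pair of sites, and pass to the limit.  (Exhaustions by unions of whole blocks are the case of use
for block-averaging operators, whose Dirichlet restrictions are coercive by a blockwise Poincaré inequality.)
[cite: CombesThomas1973, §II] [folklore] -/
theorem exists_green_of_coercive_exhaustion {T : Kernel₂ d} {R : ℕ} {γ κ ρ : ℝ} (bx : ℕ → Finset (Fin d → ℤ))
    (hbx : ∀ x, ∀ᶠ N in atTop, x ∈ bx N) (hR : HasRange T R) (hγρ : ρ < γ) (hκ : 0 ≤ κ) (hγ : 0 < γ)
    (hco : ∀ N, Coercive (Matrix.of fun i j : ↥(bx N) => T i j) γ)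
    (hrow : ∀ (x : Fin d → ℤ) (t : Finset (Fin d → ℤ)), ∑ y ∈ t, |T x y| * (Real.exp (κ * l1 (x - y)) - 1) ≤ ρ)
    (hcol : ∀ (y : Fin d → ℤ) (t : Finset (Fin d → ℤ)), ∑ x ∈ t, |T x y| * (Real.exp (κ * l1 (x - y)) - 1) ≤ ρ) :
    ∃ S : Kernel₂ d, compKer T S = kdelta ∧ compKer S T = kdelta ∧ Decay₂ S (γ - ρ)⁻¹ κ := by
  classical
  -- the extended box inverses
  set G : ℕ → Kernel₂ d := fun N x y =>
    if h : x ∈ bx N ∧ y ∈ bx N then (Matrix.of fun i j : ↥(bx N) => T i j)⁻¹ ⟨x, h.1⟩ ⟨y, h.2⟩ else 0 with hG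
  -- the compact set of kernels obeying the Combes–Thomas bound
  set B : (Fin d → ℤ) → (Fin d → ℤ) → ℝ := fun x y => (γ - ρ)⁻¹ * Real.exp (-(κ * l1 (x - y))) with hB
  have hGB : ∀ N x y, |G N x y| ≤ B x y := fun N x y => abs_extend_inv_le hγρ hκ (hco N) hrow hcol x y
  have hcpt : IsCompact {K : Kernel₂ d | ∀ x, K x ∈ {r : (Fin d → ℤ) → ℝ | ∀ y, r y ∈ Set.Icc (-B x y) (B x y)}} :=
    isCompact_pi_infinite fun x => isCompact_pi_infinite fun y => isCompact_Icc
  have hmem : ∀ N, G N ∈ {K : Kernel₂ d | ∀ x, K x ∈ {r : (Fin d → ℤ) → ℝ | ∀ y, r y ∈ Set.Icc (-B x y) (B x y)}} :=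
    fun N x y => abs_le.1 (hGB N x y)
  obtain ⟨S, hS, φ, hφ, hlim⟩ := hcpt.tendsto_subseq hmem
  have hpt : ∀ x y, Tendsto (fun n => G (φ n) x y) atTop (𝓝 (S x y)) := fun x y =>
    tendsto_pi_nhds.1 (tendsto_pi_nhds.1 hlim x) y
  -- every pair of sites is eventually inside the box `bx (φ n)`
  have hev : ∀ x z : Fin d → ℤ, ∀ᶠ n in atTop, x ∈ bx (φ n) ∧ z ∈ bx (φ n) := fun x z =>
    (hφ.tendsto_atTop.eventually (hbx x)).and (hφ.tendsto_atTop.eventually (hbx z))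
  refine ⟨S, ?_, ?_, fun x y => ?_⟩
  · funext x z
    have h1 : Tendsto (fun n => compKer T (G (φ n)) x z) atTop (𝓝 (compKer T S x z)) := by
      simp only [compKer_eq_sum_left hR]
      exact tendsto_finsetSum _ fun y _ => (hpt y z).const_mul (T x y)
    have h2 : ∀ᶠ n in atTop, compKer T (G (φ n)) x z = kdelta x z :=
      (hev x z).mono fun n hn => compKer_extend_inv hγ (hco (φ n)) hn.1 hn.2
    exact tendsto_nhds_unique h1 (tendsto_const_nhds.congr' (h2.mono fun n hn => hn.symm))
  · funext x z
    have h1 : Tendsto (fun n => compKer (G (φ n)) T x z) atTop (𝓝 (compKer S T x z)) := by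
      simp only [compKer_eq_sum_right hR]
      exact tendsto_finsetSum _ fun y _ => (hpt x y).mul_const (T y z)
    have h2 : ∀ᶠ n in atTop, compKer (G (φ n)) T x z = kdelta x z :=
      (hev x z).mono fun n hn => compKer_extend_inv' hγ (hco (φ n)) hn.1 hn.2
    exact tendsto_nhds_unique h1 (tendsto_const_nhds.congr' (h2.mono fun n hn => hn.symm))
  · simp only [Set.mem_setOf_eq, Set.mem_Icc] at hS
    have h := hS x y
    rw [neg_mul]
    exact abs_le.2 h

/-- **THE `ℤ^d` GREEN'S FUNCTION OF A COERCIVE FINITE-RANGE KERNEL — NO SMALLNESS** (all finite principal submatrices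
`γ`-coercive, equivalently `γ Σ f² ≤ Σ f T f` for finitely supported `f`; exhaustion by the cubes `[-N,N]^d`):
`∃ S, T ∘ S = δ = S ∘ T ∧ |S(x,y)| ≤ (γ − ρ)⁻¹ e^{−κ|x−y|₁}`. [cite: CombesThomas1973, §II] [folklore] -/
theorem exists_green_of_coercive {T : Kernel₂ d} {R : ℕ} {γ κ ρ : ℝ} (hR : HasRange T R) (hγρ : ρ < γ)
    (hκ : 0 ≤ κ) (hγ : 0 < γ)
    (hco : ∀ s : Finset (Fin d → ℤ), Coercive (Matrix.of fun i j : ↥s => T i j) γ)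
    (hrow : ∀ (x : Fin d → ℤ) (t : Finset (Fin d → ℤ)), ∑ y ∈ t, |T x y| * (Real.exp (κ * l1 (x - y)) - 1) ≤ ρ)
    (hcol : ∀ (y : Fin d → ℤ) (t : Finset (Fin d → ℤ)), ∑ x ∈ t, |T x y| * (Real.exp (κ * l1 (x - y)) - 1) ≤ ρ) :
    ∃ S : Kernel₂ d, compKer T S = kdelta ∧ compKer S T = kdelta ∧ Decay₂ S (γ - ρ)⁻¹ κ :=
  exists_green_of_coercive_exhaustion (fun N => Fintype.piFinset fun _ : Fin d => Finset.Icc (-(N : ℤ)) N)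
    eventually_mem_cube hR hγρ hκ hγ (fun _ => hco _) hrow hcol

/-- Periodic form along an exhaustion: with `κ > 0` and a row bound on `T`, the Green's function is jointly `n`-periodic
for every period `n` of `T` (`IsPeriodic₂.of_inverse`). [cite: CombesThomas1973, §II] [folklore] -/
theorem exists_green_of_coercive_exhaustion_periodic {T : Kernel₂ d} {R : ℕ} {γ κ ρ A : ℝ}
    (bx : ℕ → Finset (Fin d → ℤ)) (hbx : ∀ x, ∀ᶠ N in atTop, x ∈ bx N) (hR : HasRange T R) (hγρ : ρ < γ)
    (hκ : 0 < κ) (hγ : 0 < γ) (hTA : RowBound T A)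
    (hco : ∀ N, Coercive (Matrix.of fun i j : ↥(bx N) => T i j) γ)
    (hrow : ∀ (x : Fin d → ℤ) (t : Finset (Fin d → ℤ)), ∑ y ∈ t, |T x y| * (Real.exp (κ * l1 (x - y)) - 1) ≤ ρ)
    (hcol : ∀ (y : Fin d → ℤ) (t : Finset (Fin d → ℤ)), ∑ x ∈ t, |T x y| * (Real.exp (κ * l1 (x - y)) - 1) ≤ ρ) :
    ∃ S : Kernel₂ d, compKer T S = kdelta ∧ compKer S T = kdelta ∧ Decay₂ S (γ - ρ)⁻¹ κ ∧
      ∀ n : ℕ, IsPeriodic₂ n T → IsPeriodic₂ n S := by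
  obtain ⟨S, h1, h2, h3⟩ := exists_green_of_coercive_exhaustion bx hbx hR hγρ hκ.le hγ hco hrow hcol
  exact ⟨S, h1, h2, h3, fun n hn => IsPeriodic₂.of_inverse hn hTA (h3.rowBound hκ) h1 h2⟩

/-- **… AND BLOCK-PERIODIC**: if moreover `κ > 0` and `T` has a uniform row bound, the Green's function of §3 is jointly
`n`-periodic for every period `n` of `T` (uniqueness of two-sided inverses, `IsPeriodic₂.of_inverse`) — the LABELLED INPUT
`K^∞` of `EntrywiseVolumeLimit` §4 (`compKer T S = kdelta`, `Decay₂ S C δ`, joint periodicity) DISCHARGED for every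
coercive finite-range block operator, with no smallness hypothesis. [cite: CombesThomas1973, §II] [folklore] -/
theorem exists_green_of_coercive_periodic {T : Kernel₂ d} {R : ℕ} {γ κ ρ A : ℝ} (hR : HasRange T R) (hγρ : ρ < γ)
    (hκ : 0 < κ) (hγ : 0 < γ) (hTA : RowBound T A)
    (hco : ∀ s : Finset (Fin d → ℤ), Coercive (Matrix.of fun i j : ↥s => T i j) γ)
    (hrow : ∀ (x : Fin d → ℤ) (t : Finset (Fin d → ℤ)), ∑ y ∈ t, |T x y| * (Real.exp (κ * l1 (x - y)) - 1) ≤ ρ)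
    (hcol : ∀ (y : Fin d → ℤ) (t : Finset (Fin d → ℤ)), ∑ x ∈ t, |T x y| * (Real.exp (κ * l1 (x - y)) - 1) ≤ ρ) :
    ∃ S : Kernel₂ d, compKer T S = kdelta ∧ compKer S T = kdelta ∧ Decay₂ S (γ - ρ)⁻¹ κ ∧
      ∀ n : ℕ, IsPeriodic₂ n T → IsPeriodic₂ n S := by
  obtain ⟨S, h1, h2, h3⟩ := exists_green_of_coercive hR hγρ hκ.le hγ hco hrow hcol
  exact ⟨S, h1, h2, h3, fun n hn => IsPeriodic₂.of_inverse hn hTA (h3.rowBound hκ) h1 h2⟩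


/-! ## §4. Discharging the hypotheses from ELEMENTARY data: the form on finitely supported functions, finite range with
an entry bound (weighted sums, row bound), and the headline `∃ κ > 0` packaging -/

/-- The coercivity hypothesis of §3 from the quadratic form on FINITELY SUPPORTED functions:
`γ Σ_{x∈t} f(x)² ≤ Σ_{x,y∈t} f(x) T(x,y) f(y)` for every finset `t` and every `f`. [cite: CombesThomas1973, §II] [folklore] -/
theorem coercive_restrict_of_form {T : Kernel₂ d} {γ : ℝ}
    (h : ∀ (t : Finset (Fin d → ℤ)) (f : (Fin d → ℤ) → ℝ),
      γ * ∑ x ∈ t, f x ^ 2 ≤ ∑ x ∈ t, ∑ y ∈ t, f x * T x y * f y)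
    (s : Finset (Fin d → ℤ)) : Coercive (Matrix.of fun i j : ↥s => T i j) γ := by
  classical
  intro v
  set f : (Fin d → ℤ) → ℝ := fun x => if hx : x ∈ s then v ⟨x, hx⟩ else 0 with hf
  have hfv : ∀ i : ↥s, f i = v i := fun i => by
    have hi : (i : Fin d → ℤ) ∈ s := i.2
    simp only [hf, hi, ↓reduceDIte, Subtype.coe_eta]
  have h1 : v ⬝ᵥ v = ∑ x ∈ s, f x ^ 2 := by
    rw [← Finset.sum_coe_sort s (fun x => f x ^ 2)]
    simp only [dotProduct, hfv, pow_two]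
  have h2 : v ⬝ᵥ (Matrix.of (fun i j : ↥s => T i j)).mulVec v = ∑ x ∈ s, ∑ y ∈ s, f x * T x y * f y := by
    rw [← Finset.sum_coe_sort s (fun x => ∑ y ∈ s, f x * T x y * f y)]
    simp only [dotProduct, Matrix.mulVec, Matrix.of_apply]
    refine Finset.sum_congr rfl fun i _ => ?_
    rw [← Finset.sum_coe_sort s (fun y => f i * T i y * f y), Finset.mul_sum]
    exact Finset.sum_congr rfl fun j _ => by rw [hfv i, hfv j]; ring
  rw [h1, h2]
  exact h s f

/-- In the sup-ball of radius `R` around `x`, `|x − y|₁ ≤ d·R`.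
[cite: Balaban1984PropagatorsII, Lemma 2.1 p.234] [folklore] -/
theorem l1_le_of_mem_nbhd {R : ℕ} {x y : Fin d → ℤ}
    (hy : y ∈ Fintype.piFinset fun i : Fin d => Finset.Icc (x i - R) (x i + R)) : l1 (x - y) ≤ d * R := by
  have hco : ∀ i, |((x - y) i : ℝ)| ≤ R := by
    intro i
    have h := Finset.mem_Icc.1 (Fintype.mem_piFinset.1 hy i)
    have h' : |x i - y i| ≤ (R : ℤ) := abs_le.2 ⟨by linarith [h.2], by linarith [h.1]⟩
    have h'' : |((x i - y i : ℤ) : ℝ)| ≤ (R : ℝ) := by exact_mod_cast h'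
    simpa [Pi.sub_apply] using h''
  calc l1 (x - y) = ∑ i : Fin d, |((x - y) i : ℝ)| := rfl
    _ ≤ ∑ _i : Fin d, (R : ℝ) := Finset.sum_le_sum fun i _ => hco i
    _ = d * R := by simp

/-- The sup-ball of radius `R` has `(2R + 1)^d` sites. [cite: Balaban1984PropagatorsII, Lemma 2.1 p.234] [folklore] -/
theorem card_nbhd (x : Fin d → ℤ) (R : ℕ) :
    ((Fintype.piFinset fun i : Fin d => Finset.Icc (x i - R) (x i + R)).card : ℝ) = (2 * R + 1) ^ d := by
  rw [Fintype.card_piFinset]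
  rw [Finset.prod_congr rfl (fun i _ => show (Finset.Icc (x i - R) (x i + R)).card = 2 * R + 1 by
    rw [Int.card_Icc]; omega)]
  simp

/-- **WEIGHTED ROW SUMS FROM FINITE RANGE**: `HasRange T R`, off-diagonal entries `|T(x,y)| ≤ a` (`a, κ ≥ 0`) ⟹
`Σ_{y∈t} |T(x,y)| (e^{κ|x−y|₁} − 1) ≤ a (2R+1)^d (e^{κ d R} − 1)` for every finset `t` — a bound that tends to `0` with
`κ`. [cite: Balaban1984PropagatorsII, Lemma 2.1 p.234] [folklore] -/
theorem weightedRowSum_le_of_hasRange {T : Kernel₂ d} {R : ℕ} {a κ : ℝ} (hT : HasRange T R)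
    (ha : ∀ x y, x ≠ y → |T x y| ≤ a) (ha0 : 0 ≤ a) (hκ : 0 ≤ κ) (x : Fin d → ℤ) (t : Finset (Fin d → ℤ)) :
    ∑ y ∈ t, |T x y| * (Real.exp (κ * l1 (x - y)) - 1) ≤ a * (2 * R + 1) ^ d * (Real.exp (κ * (d * R)) - 1) := by
  classical
  set nb := Fintype.piFinset fun i : Fin d => Finset.Icc (x i - R) (x i + R) with hnb
  set g : (Fin d → ℤ) → ℝ := fun y => |T x y| * (Real.exp (κ * l1 (x - y)) - 1) with hg
  have hg0 : ∀ y, 0 ≤ g y := fun y =>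
    mul_nonneg (abs_nonneg _) (by linarith [Real.one_le_exp (mul_nonneg hκ (l1_nonneg (x - y)))])
  have hgle : ∀ y ∈ nb, g y ≤ a * (Real.exp (κ * (d * R)) - 1) := by
    intro y hy
    by_cases hxy : x = y
    · subst hxy
      have : g x = 0 := by simp [hg, B12Sec2to5.l1]
      rw [this]
      exact mul_nonneg ha0 (by linarith [Real.one_le_exp (mul_nonneg hκ (by positivity : (0 : ℝ) ≤ d * R))])
    · have hw : Real.exp (κ * l1 (x - y)) - 1 ≤ Real.exp (κ * (d * R)) - 1 := by
        linarith [Real.exp_le_exp.2 (mul_le_mul_of_nonneg_left (l1_le_of_mem_nbhd hy) hκ)]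
      exact mul_le_mul (ha x y hxy) hw (by linarith [Real.one_le_exp (mul_nonneg hκ (l1_nonneg (x - y)))]) ha0
  have hvan : ∀ y ∈ t, y ∉ t ∩ nb → g y = 0 := by
    intro y hy hyn
    have hy' : y ∉ nb := fun h => hyn (Finset.mem_inter.2 ⟨hy, h⟩)
    simp [hg, eq_zero_of_not_mem_nbhd hT hy']
  calc ∑ y ∈ t, g y = ∑ y ∈ t ∩ nb, g y := (Finset.sum_subset Finset.inter_subset_left hvan).symm
    _ ≤ ∑ y ∈ nb, g y := Finset.sum_le_sum_of_subset_of_nonneg Finset.inter_subset_right fun y _ _ => hg0 y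
    _ ≤ ∑ _y ∈ nb, a * (Real.exp (κ * (d * R)) - 1) := Finset.sum_le_sum hgle
    _ = a * (2 * R + 1) ^ d * (Real.exp (κ * (d * R)) - 1) := by
        rw [Finset.sum_const, nsmul_eq_mul, card_nbhd]; ring

/-- The transposed kernel has the same range. [cite: Balaban1984PropagatorsII, Lemma 2.1 p.234] [folklore] -/
theorem hasRange_transpose {T : Kernel₂ d} {R : ℕ} (hT : HasRange T R) : HasRange (fun x y => T y x) R :=
  fun x y ⟨i, hi⟩ => hT y x ⟨i, by rwa [abs_sub_comm]⟩

/-- **WEIGHTED COLUMN SUMS FROM FINITE RANGE** (the row lemma for the transposed kernel).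
[cite: Balaban1984PropagatorsII, Lemma 2.1 p.234] [folklore] -/
theorem weightedColSum_le_of_hasRange {T : Kernel₂ d} {R : ℕ} {a κ : ℝ} (hT : HasRange T R)
    (ha : ∀ x y, x ≠ y → |T x y| ≤ a) (ha0 : 0 ≤ a) (hκ : 0 ≤ κ) (y : Fin d → ℤ) (t : Finset (Fin d → ℤ)) :
    ∑ x ∈ t, |T x y| * (Real.exp (κ * l1 (x - y)) - 1) ≤ a * (2 * R + 1) ^ d * (Real.exp (κ * (d * R)) - 1) := by
  have h := weightedRowSum_le_of_hasRange (hasRange_transpose hT) (fun x' y' hne => ha y' x' (Ne.symm hne)) ha0 hκ y t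
  refine le_trans (le_of_eq (Finset.sum_congr rfl fun x _ => ?_)) h
  rw [l1_sub_comm]

/-- **ROW BOUND FROM FINITE RANGE**: `HasRange T R` and `|T(x,y)| ≤ a` ⟹ `RowBound T (a (2R+1)^d)`.
[cite: Balaban1984PropagatorsII, Lemma 2.1 p.234] [folklore] -/
theorem rowBound_of_hasRange {T : Kernel₂ d} {R : ℕ} {a : ℝ} (hT : HasRange T R) (ha : ∀ x y, |T x y| ≤ a) :
    RowBound T (a * (2 * R + 1) ^ d) := by
  classical
  intro x
  set nb := Fintype.piFinset fun i : Fin d => Finset.Icc (x i - R) (x i + R) with hnb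
  have hvan : ∀ y ∉ nb, |T x y| = 0 := fun y hy => by rw [eq_zero_of_not_mem_nbhd hT hy, abs_zero]
  have hsum : Summable fun y => |T x y| := summable_of_ne_finset_zero hvan
  refine ⟨hsum, ?_⟩
  rw [tsum_eq_sum hvan]
  calc ∑ y ∈ nb, |T x y| ≤ ∑ _y ∈ nb, a := Finset.sum_le_sum fun y _ => ha x y
    _ = a * (2 * R + 1) ^ d := by rw [Finset.sum_const, nsmul_eq_mul, card_nbhd]; ring

/-- `Decay₂` is monotone in the constant. [cite: Balaban1987RG1, (5.10) p.293] [folklore] -/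
theorem decay₂_mono {K : Kernel₂ d} {C C' δ : ℝ} (h : Decay₂ K C δ) (hC : C ≤ C') : Decay₂ K C' δ :=
  fun x y => (h x y).trans (mul_le_mul_of_nonneg_right hC (Real.exp_pos _).le)

/-- **HEADLINE — THE GREEN'S FUNCTION OF A COERCIVE LOCAL OPERATOR ON `ℤ^d` DECAYS EXPONENTIALLY.**  `T` of finite range
`R` with bounded entries whose finite principal submatrices are uniformly `γ`-coercive (`γ > 0`) has a two-sided inverse
kernel `S` on `ℤ^d` with `|S(x,y)| ≤ (2∕γ) e^{−κ|x−y|₁}` for some `κ > 0` (depending on `d, R, a, γ` only), jointly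
`n`-periodic for every block period `n` of `T`.  No smallness of `T − diag` is assumed (contrast
`RemainderKernelNeumannExistence.exists_green_of_perturbation`).  This is the `ℤ^d` Green's function `K^∞` that
`EntrywiseVolumeLimit` §4 takes as a LABELLED INPUT, for the whole coercive class. [cite: CombesThomas1973, §II] [folklore] -/
theorem exists_green_of_coercive_hasRange {T : Kernel₂ d} {R : ℕ} {γ a : ℝ} (hT : HasRange T R) (hγ : 0 < γ)
    (ha : ∀ x y, |T x y| ≤ a)
    (hco : ∀ s : Finset (Fin d → ℤ), Coercive (Matrix.of fun i j : ↥s => T i j) γ) :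
    ∃ κ : ℝ, 0 < κ ∧ ∃ S : Kernel₂ d, compKer T S = kdelta ∧ compKer S T = kdelta ∧ Decay₂ S (2 / γ) κ ∧
      ∀ n : ℕ, IsPeriodic₂ n T → IsPeriodic₂ n S := by
  have ha0 : 0 ≤ a := (abs_nonneg _).trans (ha 0 0)
  -- a rate `κ > 0` with `ρ(κ) = a (2R+1)^d (e^{κ d R} − 1) < γ/2`
  have hcont : ContinuousAt (fun κ : ℝ => a * (2 * R + 1) ^ d * (Real.exp (κ * (d * R)) - 1)) 0 :=
    Continuous.continuousAt (by fun_prop)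
  have h0 : (fun κ : ℝ => a * (2 * R + 1) ^ d * (Real.exp (κ * (d * R)) - 1)) 0 < γ / 2 := by
    simp only [zero_mul, Real.exp_zero, sub_self, mul_zero]
    linarith
  have hev : ∀ᶠ κ in 𝓝 (0 : ℝ), a * (2 * R + 1) ^ d * (Real.exp (κ * (d * R)) - 1) < γ / 2 :=
    hcont.eventually_mem (Iio_mem_nhds h0)
  obtain ⟨κ, hκρ, hκ0⟩ := ((hev.filter_mono nhdsWithin_le_nhds).and
    (self_mem_nhdsWithin : Set.Ioi (0 : ℝ) ∈ 𝓝[>] (0 : ℝ))).exists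
  have hκ0' : 0 < κ := hκ0
  have hγρ : a * (2 * R + 1) ^ d * (Real.exp (κ * (d * R)) - 1) < γ := by linarith
  obtain ⟨S, h1, h2, h3, h4⟩ := exists_green_of_coercive_periodic hT hγρ hκ0' hγ (rowBound_of_hasRange hT ha) hco
    (weightedRowSum_le_of_hasRange hT (fun x y _ => ha x y) ha0 hκ0'.le)
    (weightedColSum_le_of_hasRange hT (fun x y _ => ha x y) ha0 hκ0'.le)
  refine ⟨κ, hκ0', S, h1, h2, decay₂_mono h3 ?_, h4⟩
  have hpos : γ / 2 ≤ γ - a * (2 * R + 1) ^ d * (Real.exp (κ * (d * R)) - 1) := by linarith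
  calc (γ - a * (2 * R + 1) ^ d * (Real.exp (κ * (d * R)) - 1))⁻¹ ≤ (γ / 2)⁻¹ :=
        inv_anti₀ (by linarith) hpos
    _ = 2 / γ := inv_div γ 2

end Literature.MathematicalPhysics.QuantumFieldTheory.Balaban1983to89.Beta.RemainderKernelGreenCoercive
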